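import Literature.Analysis.FunctionSpaces.TorusCalculusProofs
import Literature.Analysis.FluidPDE.WaveKinetic
import HarnessLib
import Mathlib.Analysis.InnerProductSpace.ProdL2
import Mathlib.MeasureTheory.Measure.Haar.Unique
import Mathlib.Analysis.SpecialFunctions.JapaneseBracket
import Mathlib.MeasureTheory.Function.SpecialFunctions.Inner
import Mathlib.MeasureTheory.Constructions.HaarToSphere
import Mathlib.MeasureTheory.Group.Integral
import Mathlib.MeasureTheory.Integral.Prod
import Mathlib.Analysis.Calculus.MeanValue
import Mathlib.MeasureTheory.Integral.DominatedConvergence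

/-!
# Discharged facts of `Literature.Analysis.FluidPDE.WaveKinetic`

(trunk: FluidKinetic / T-KINETIC; companion ("Proofs") file of
`Literature.Analysis.FluidPDE.WaveKinetic`, discharging its named facts. Extend it by appending
new sections.)

1. `Literature.Analysis.FluidPDE.WaveKinetic.IsCubicNLSOn.nlsMass_eq_holds` — mass conservation for the cubic NLS on the
   unit torus (§1).
2. `Literature.Analysis.FluidPDE.WaveKinetic.IsWKESolutionOn.mass_conserved_holds` — conservation of mass (wave action)
   for classical solutions of the four-wave kinetic equation (§2; the key intermediate result is
   `Literature.Analysis.FluidPDE.WaveKinetic.integral_collision_eq_zero`, `∫ 𝒦(m)(k) dk = 0`).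

## 1. Mass conservation for the cubic NLS on the unit torus

`Literature.Analysis.FluidPDE.WaveKinetic` records, as the named fact
`WaveKinetic.IsCubicNLSOn.nlsMass_eq` (`def … : Prop`), the conservation of the mass
`M(u) = ∫_{T^d} |u|²` along smooth solutions of the cubic nonlinear Schrödinger equation
`i ∂ₜu − β Δu + α |u|² u = 0` on `[0, T] × T^d`. This file proves it
(`WaveKinetic.IsCubicNLSOn.nlsMass_eq_holds`), following the textbook argument (Erdoğan–Tzirakis
2016, §3.5: "the smooth solutions to the equation satisfy the `L²` norm conservation"; Deng–Hani
2021, §1: the `L²` space is "conserved"): multiply the equation by `ū`, take imaginary parts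
(here: real inner products on `ℂ` viewed as a real inner product space), integrate over the
torus and integrate by parts.

In detail, for `T > 0` (for `T ≤ 0` the claim is trivial) and `S = [0, T]`:

* `s ↦ M(u(s))` has one-sided derivative `∫ ∂ₜ|u|²(t, x) dx` within `S` at every `t ∈ S`
  (differentiation under `∫_{T^d}` for jointly smooth fields,
  `Torus.IsSmoothSpaceTimeOn.hasDerivWithinAt_integral`), and `∂ₜ|u|² = 2⟪u, ∂ₜu⟫_ℝ`;
* the equation gives `∂ₜu = -i(βΔu − α|u|²u)`, whence `⟪u, ∂ₜu⟫_ℝ = β ⟪iu, Δu⟫_ℝ` pointwise (the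
  nonlinear term contributes `Re(iα|u|⁴) = 0`);
* `∫ ⟪iu, Δu⟫_ℝ = -∑ⱼ ∫ ⟪∂ⱼ(iu), ∂ⱼu⟫_ℝ = -∑ⱼ ∫ ⟪i∂ⱼu, ∂ⱼu⟫_ℝ = 0` by Green's first identity on
  the torus in bilinear form (`Torus.integral_inner_laplacian_eq_neg_sum_inner`, proved here from
  `Torus.integral_partialDeriv_eq_zero_holds`; Evans, App. C.2, Thm. 3, empty boundary) and
  `⟪iz, z⟫_ℝ = 0`;
* a function with vanishing one-sided derivative on the convex set `S` is constant
  (`Convex.norm_image_sub_le_of_norm_hasDerivWithin_le` with constant `0`).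

The statement was found faithful as vendored (not mis-stated).

## 2. Conservation of wave action for the wave kinetic equation
(discharge of the named fact `Literature.Analysis.FluidPDE.WaveKinetic.IsWKESolutionOn.mass_conserved`)

Source: S. Nazarenko, *Wave Turbulence*, LNP 825 (Springer 2011), §8.1.3 "Four-Wave Systems",
eqs. (8.18)–(8.22): for a density `ρ_k` one has
`Φ̇ = ∫ ρ_k ṅ_k dk = ∫ (ρ_k + ρ₃ − ρ₁ − ρ₂) |W|² δ δ(ω) n₁ n₂ n₃ n_k dk₁ dk₂ dk₃ dk` after the
changes of variables `k ⇄ k₃`, `k ⇄ k₁`, `k ⇄ k₂` in the second, third and fourth terms of the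
collision integrand, so `ρ ≡ 1` gives conservation of the wave action `N = ∫ n_k dk` ((8.22); the
"number of particles"). The printed argument is formal. The vendored fact supplies the
regularity making it rigorous (continuity in time, `|n(t, k)| ≤ C (1 + |k|)^{-s}` with
`s > dim E ≥ 3`, measurability), and the proof below is organised as follows
(parametrisation of `WaveKinetic.collision`: `k₁ = k + a`, `k₃ = k + b`, `k₂ = k + a + b` with
`b ∈ (ℝ ∙ a)ᗮ` and weight `(2|a|)⁻¹`).

* Section `Hyperplane`: `exists_lineHyperplane_measurableEquiv` — the orthogonal decomposition
  `ℝ × (ℝ ∙ a)ᗮ ≃ E`, `(t, b) ↦ t a/|a| + b`, preserves Lebesgue measure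
  (Mathlib's `Submodule.orthogonalDecomposition` + `WithLp.volume_preserving_toLp`); hence a
  hyperplane integral is a slab integral over `E` (`lintegral_hyperplane_eq_lintegral_slab`,
  `integral_hyperplane_eq_integral_slab`), which gives measurability of
  `a ↦ (2|a|)⁻¹ ∫_{(ℝ ∙ a)ᗮ} Φ(a, b) db` in parameters (the domain of integration varies with `a`).
* Section `Weight`: for a weight `β : E → ℝ≥0∞` with `β x ≤ A β y` whenever `|y| ≤ 1 + 2|x|`
  (the bracket `⟨x⟩^{-s} = (1 + |x|)^{-s}` has this with `A = 2^s`): the two-point bound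
  `∫ β(k+u) β(k+w) dk ≤ 2 A C₀ β(u−w)` (`C₀ = ∫ β`), the three-point bound derived from it by a
  case distinction on the distance of `k` to the far pair, the uniform hyperplane bound
  `∫_{(ℝ∙a)ᗮ} β ≤ A C₀`; and, for the bracket (`C₀ < ∞` for `s > dim E` is Mathlib's
  `finite_integral_one_add_norm`), the local integrability
  of `(2|a|)⁻¹ ⟨a⟩^{-s}` (`dim E ≥ 2`, polar coordinates).
* Section `Majorant`: `‖cubicForm m k k₁ k₂ k₃‖ ≤ c³ Σ β β β` (sum of the four triple products
  omitting one argument) when `‖m‖ ≤ c β`; on the resonant manifold (`b ⊥ a`, so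
  `|a ± b|² = |a|² + |b|²` and the far pair of each term is at distance `≥ |a|, |b|`)
  `∫_k Σ β β β dk ≲ β(a) β(b)`, whence `∫_k ∫_a (2|a|)⁻¹ ∫_{b ⊥ a} Σ β β β < ∞` (Tonelli,
  integrating `k` first).
* Section `Vanishing`: `∫ 𝒦(m)(k) dk = 0` for measurable `|m| ≤ C ⟨·⟩^{-s}`: Fubini in `(k, a)`,
  the substitutions `a ↦ −a`, `k ↦ k + a` (Nazarenko's `(k, k₂) ⇄ (k₁, k₃)`), and the pointwise
  antisymmetry `cubicForm m (k+a) k (k+b) (k+a+b) = −cubicForm m k (k+a) (k+a+b) (k+b)`.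
* Section `MassConservation`: the mass `M(t) = ∫ n(t, k) dk` is continuous on `[0, t]`
  (dominated convergence) and has right derivative `∫ 𝒦(n(τ))(k) dk = 0` at every `τ`
  (dominated convergence for the difference quotients: the right-derivative mean value
  inequality `norm_image_sub_le_of_norm_deriv_right_le_segment` and the time-uniform majorant give
  `|n(τ+h, k) − n(τ, k)| ≤ h g(k)` with `g` integrable), hence is constant
  (`constant_of_has_deriv_right_zero`). No joint measurability of `n` in `(t, k)` is needed.

Only the decay `|n| ≤ C ⟨k⟩^{-s}` with `s > dim E` and `dim E ≥ 2` are used (the fact assumes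
`dim E ≥ 3`); the constants are not optimised.

## References

* M. B. Erdoğan, N. Tzirakis, *Dispersive Partial Differential Equations: Wellposedness and
  Applications*, LMS Student Texts 86, Cambridge Univ. Press (2016), §3.5 (p. 85: `L²` norm
  conservation for smooth solutions of the cubic/quintic NLS on the torus).
* Y. Deng, Z. Hani, *On the derivation of the wave kinetic equation for NLS*, Forum Math. Pi 9
  (2021), e6, §1 (NLS), "the conserved `L²` space" (arXiv:1912.09518, p. 3).
* L. C. Evans, *Partial Differential Equations*, 2nd ed., GSM 19 (2010), App. C.2, Thm. 3
  (Green's formulas; on `T^d` the boundary terms are absent).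
* S. Nazarenko, *Wave Turbulence*, Lecture Notes in Physics 825, Springer (2011), §8.1.3
  (conservation laws of four-wave systems), eqs. (8.18)–(8.22) (wave action: (8.22)).
-/

open MeasureTheory Set Topology Filter
open scoped InnerProductSpace ContDiff ComplexConjugate

noncomputable section

namespace Literature.Analysis.FluidPDE

namespace Torus

variable {d : Type*} [Fintype d] [DecidableEq d]
variable {G : Type*} [NormedAddCommGroup G] [InnerProductSpace ℝ G]

/-- Green's first identity on the torus in bilinear form, for smooth fields with values in a
real inner product space: `∫ ⟪a, Δb⟫ = -∑ᵢ ∫ ⟪∂ᵢa, ∂ᵢb⟫` (`⟪a, ∂ᵢ∂ᵢb⟫ = ∂ᵢ⟪a, ∂ᵢb⟫ - ⟪∂ᵢa, ∂ᵢb⟫`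
and `∫ ∂ᵢ(·) = 0`; the diagonal case `a = b` is `Torus.integral_inner_laplacian_eq_neg_holds`)
(Evans, App. C.2, Thm. 3 (i)/(ii), empty boundary). [cite: Evans2010, App. C.2 Thm. 3 (i)] -/
theorem integral_inner_laplacian_eq_neg_sum_inner {a b : UnitAddTorus d → G} (ha : FunctionSpaces.Torus.IsSmooth a)
    (hb : FunctionSpaces.Torus.IsSmooth b) :
    ∫ x, ⟪a x, FunctionSpaces.Torus.laplacian b x⟫_ℝ = -∑ i, ∫ x, ⟪FunctionSpaces.Torus.partialDeriv i a x, FunctionSpaces.Torus.partialDeriv i b x⟫_ℝ := by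
  have ha1 : FunctionSpaces.Torus.IsContDiff 1 a := ha.isContDiff (by simp)
  have hb1 : ∀ i, FunctionSpaces.Torus.IsContDiff 1 (FunctionSpaces.Torus.partialDeriv i b) := fun i =>
    (hb.partialDeriv i).isContDiff (by simp)
  have hpt : ∀ x, ⟪a x, FunctionSpaces.Torus.laplacian b x⟫_ℝ =
      ∑ i, (FunctionSpaces.Torus.partialDeriv i (fun y => ⟪a y, FunctionSpaces.Torus.partialDeriv i b y⟫_ℝ) x -
        ⟪FunctionSpaces.Torus.partialDeriv i a x, FunctionSpaces.Torus.partialDeriv i b x⟫_ℝ) := by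
    intro x
    rw [FunctionSpaces.Torus.laplacian_eq_sum_partialDeriv_partialDeriv hb, inner_sum]
    refine Finset.sum_congr rfl fun i _ => ?_
    rw [FunctionSpaces.Torus.partialDeriv_inner ha1 (hb1 i)]
    ring
  simp_rw [hpt]
  rw [integral_finsetSum _ fun i _ => ?_, ← Finset.sum_neg_distrib]
  · refine Finset.sum_congr rfl fun i _ => ?_
    rw [integral_sub, FunctionSpaces.Torus.integral_partialDeriv_eq_zero_holds (ha.inner (hb.partialDeriv i)) i,
      zero_sub]
    · exact ((ha.inner (hb.partialDeriv i)).partialDeriv i).integrable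
    · exact ((ha.partialDeriv i).inner (hb.partialDeriv i)).integrable
  · exact ((ha.inner (hb.partialDeriv i)).partialDeriv i).integrable.sub
      ((ha.partialDeriv i).inner (hb.partialDeriv i)).integrable

end Torus

namespace WaveKinetic

open Complex (I)

variable {d : Type*} [Fintype d] [DecidableEq d]

/-- `⟪i z, z⟫_ℝ = Re(z · conj(i z)) = Re(-i |z|²) = 0` on `ℂ` viewed as a real inner product
space. [folklore] -/
theorem real_inner_I_mul_self (z : ℂ) : ⟪I * z, z⟫_ℝ = 0 := by
  rw [Complex.inner, map_mul, Complex.conj_I]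
  simp only [Complex.mul_re, Complex.mul_im, Complex.neg_re, Complex.neg_im, Complex.I_re,
    Complex.I_im, Complex.conj_re, Complex.conj_im]
  ring

/-- The pointwise identity behind mass conservation: if `∂ₜu = -i(βD − r u)` with `β`, `r` real,
then `⟪u, ∂ₜu⟫_ℝ = β ⟪iu, D⟫_ℝ` (the term `r u` contributes `Re(i r |u|²) = 0`). [folklore] -/
theorem real_inner_neg_I_mul_sub (w D : ℂ) (β r : ℝ) :
    ⟪w, -I * ((β : ℂ) * D - (r : ℂ) * w)⟫_ℝ = β * ⟪I * w, D⟫_ℝ := by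
  rw [Complex.inner, Complex.inner, map_mul, Complex.conj_I]
  simp only [Complex.mul_re, Complex.mul_im, Complex.neg_re, Complex.neg_im, Complex.sub_re,
    Complex.sub_im, Complex.I_re, Complex.I_im, Complex.ofReal_re, Complex.ofReal_im,
    Complex.conj_re, Complex.conj_im]
  ring

omit [Fintype d] in
/-- Multiplication by `i` commutes with partial derivatives on the torus (`deriv` of a constant
multiple). [folklore] -/
theorem partialDeriv_I_mul (f : UnitAddTorus d → ℂ) (i : d) (x : UnitAddTorus d) :
    FunctionSpaces.Torus.partialDeriv i (fun y => I * f y) x = I * FunctionSpaces.Torus.partialDeriv i f x := by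
  simp only [FunctionSpaces.Torus.partialDeriv, FunctionSpaces.Torus.lineDeriv]
  exact deriv_const_mul_field I

omit [DecidableEq d] in
/-- Multiples `i u` of smooth `u : T^d → ℂ` are smooth. [folklore] -/
theorem isSmooth_I_mul {f : UnitAddTorus d → ℂ} (hf : FunctionSpaces.Torus.IsSmooth f) :
    FunctionSpaces.Torus.IsSmooth (fun y => I * f y) := by
  change ContDiff ℝ ∞ (fun z => I * FunctionSpaces.Torus.lift f z)
  exact contDiff_const.mul hf

/-- `Im ∫ ū Δu = 0` on the torus, in real-inner-product form: `∫ ⟪iu, Δu⟫_ℝ = 0` for smooth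
`u : T^d → ℂ` (Green's first identity `∫ ⟪iu, Δu⟫ = -∑ⱼ ∫ ⟪i∂ⱼu, ∂ⱼu⟫` and `⟪iz, z⟫_ℝ = 0`;
Evans, App. C.2, Thm. 3, empty boundary). [cite: Evans2010, App. C.2 Thm. 3 (i)] -/
theorem integral_real_inner_I_mul_laplacian_eq_zero {f : UnitAddTorus d → ℂ}
    (hf : FunctionSpaces.Torus.IsSmooth f) : ∫ x, ⟪I * f x, FunctionSpaces.Torus.laplacian f x⟫_ℝ = 0 := by
  have h := Torus.integral_inner_laplacian_eq_neg_sum_inner (isSmooth_I_mul hf) hf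
  simp only [partialDeriv_I_mul, real_inner_I_mul_self, integral_zero, Finset.sum_const_zero,
    neg_zero] at h
  exact h

/-- Discharge of the named fact `WaveKinetic.IsCubicNLSOn.nlsMass_eq`: **mass conservation for
the cubic NLS** on the unit torus. A smooth solution of `i ∂ₜu − β Δu + α |u|² u = 0` on
`[0, T] × T^d` satisfies `∫ |u(t)|² = ∫ |u(0)|²` for `t ∈ [0, T]`: differentiate under the
integral (`Torus.IsSmoothSpaceTimeOn.hasDerivWithinAt_integral`), `∂ₜ|u|² = 2⟪u, ∂ₜu⟫_ℝ =
2β⟪iu, Δu⟫_ℝ` by the equation (the nonlinear term is purely imaginary against `ū`),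
`∫ ⟪iu, Δu⟫_ℝ = 0` by integration by parts on the torus
(`integral_real_inner_I_mul_laplacian_eq_zero`), and a function with zero one-sided derivative
on `[0, T]` is constant (Erdoğan–Tzirakis 2016, §3.5, p. 85; Deng–Hani 2021, §1, "the conserved
`L²` space"). [cite: ErdoganTzirakis2016, §3.5 p. 85] -/
theorem IsCubicNLSOn.nlsMass_eq_holds : IsCubicNLSOn.nlsMass_eq (d := d) := by
  intro T β α u hu t ht
  rcases le_or_gt T 0 with hT | hT
  · rw [le_antisymm (ht.2.trans hT) ht.1]
  set S : Set ℝ := Icc 0 T with hS_def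
  have hS : Convex ℝ S := convex_Icc 0 T
  have hU : UniqueDiffOn ℝ S := uniqueDiffOn_Icc hT
  have hsm : FunctionSpaces.Torus.IsSmoothSpaceTimeOn S u := hu.1
  -- Step 1: differentiate the mass under the integral sign.
  have hφ : FunctionSpaces.Torus.IsSmoothSpaceTimeOn S (fun τ x => ‖u τ x‖ ^ 2) := by
    change ContDiffOn ℝ ∞ (fun z => ‖FunctionSpaces.Torus.stLift u z‖ ^ 2) (S ×ˢ univ)
    exact hsm.norm_sq ℝ
  have hM : ∀ s ∈ S, HasDerivWithinAt (fun τ => nlsMass (u τ))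
      (∫ x, FunctionSpaces.Torus.timeDerivWithin S (fun τ x => ‖u τ x‖ ^ 2) s x) S s :=
    fun s hs => hφ.hasDerivWithinAt_integral hS hs
  -- Step 2: the derivative vanishes at every time.
  have hzero : ∀ s ∈ S, ∫ x, FunctionSpaces.Torus.timeDerivWithin S (fun τ x => ‖u τ x‖ ^ 2) s x = 0 := by
    intro s hs
    have hus : FunctionSpaces.Torus.IsSmooth (u s) := hsm.isSmooth_slice hs
    have hpt : ∀ x, FunctionSpaces.Torus.timeDerivWithin S (fun τ x => ‖u τ x‖ ^ 2) s x =
        2 * β * ⟪I * u s x, FunctionSpaces.Torus.laplacian (u s) x⟫_ℝ := by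
      intro x
      have h1 : FunctionSpaces.Torus.timeDerivWithin S (fun τ x => ‖u τ x‖ ^ 2) s x =
          2 * ⟪u s x, FunctionSpaces.Torus.timeDerivWithin S u s x⟫_ℝ :=
        ((hsm.hasDerivWithinAt_slice hs x).norm_sq).derivWithin (hU s hs)
      have heq := hu.2 s hs x
      have hsolve : FunctionSpaces.Torus.timeDerivWithin S u s x =
          -I * ((β : ℂ) * FunctionSpaces.Torus.laplacian (u s) x - ((α * ‖u s x‖ ^ 2 : ℝ) : ℂ) * u s x) := by
        linear_combination -I * heq + FunctionSpaces.Torus.timeDerivWithin S u s x * Complex.I_mul_I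
      rw [h1, hsolve, real_inner_neg_I_mul_sub]
      ring
    simp_rw [hpt]
    rw [integral_const_mul, integral_real_inner_I_mul_laplacian_eq_zero hus, mul_zero]
  -- Step 3: zero one-sided derivative on the interval `[0, T]` forces constancy.
  have hbound : ∀ s ∈ S,
      ‖∫ x, FunctionSpaces.Torus.timeDerivWithin S (fun τ x => ‖u τ x‖ ^ 2) s x‖ ≤ 0 := fun s hs => by
    rw [hzero s hs, norm_zero]
  have h := hS.norm_image_sub_le_of_norm_hasDerivWithin_le hM hbound (left_mem_Icc.2 hT.le) ht
  rw [zero_mul, norm_le_zero_iff, sub_eq_zero] at h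
  exact h

end WaveKinetic

end Literature.Analysis.FluidPDE

/-! ## 2. Conservation of wave action for the wave kinetic equation
(discharge of the named fact `Literature.Analysis.FluidPDE.WaveKinetic.IsWKESolutionOn.mass_conserved`; the module
docstring describes the argument) -/

open Module
open scoped ENNReal NNReal

namespace Literature.Analysis.FluidPDE

namespace WaveKinetic

variable {E : Type*} [NormedAddCommGroup E] [InnerProductSpace ℝ E] [FiniteDimensional ℝ E]
  [MeasurableSpace E] [BorelSpace E]

/-! ### 2.1 Hyperplane integrals -/

section Hyperplane

/-- **Fubini along a hyperplane**: for `a ≠ 0` there is a measurable equivalence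
`ℝ × (ℝ ∙ a)ᗮ ≃ E` given by `(t, b) ↦ t • (a/|a|) + b` which maps `dt ⊗ vol_{(ℝ∙a)ᗮ}` to Lebesgue
measure on `E` (all three are the Lebesgue measures of the inner product spaces `ℝ`, `(ℝ ∙ a)ᗮ`,
`E`, normalised on orthonormal parallelepipeds). It is assembled from Mathlib's
`Submodule.orthogonalDecomposition` of `E` along `ℝ ∙ a` (an isometry onto
`WithLp 2 ((ℝ ∙ a) × (ℝ ∙ a)ᗮ)`, volume preserving by `WithLp.volume_preserving_toLp`) and the
isometry `ℝ ≃ ℝ ∙ a`, `t ↦ t • a/|a|`. [folklore] -/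
theorem exists_lineHyperplane_measurableEquiv {a : E} (ha : a ≠ 0) :
    ∃ e : ℝ × ↥(ℝ ∙ a)ᗮ ≃ᵐ E, MeasurePreserving e (volume.prod volume) volume ∧
      ∀ p, e p = p.1 • (‖a‖⁻¹ • a) + (p.2 : E) := by
  have hâ : ‖(‖a‖⁻¹ • a : E)‖ = 1 := by
    rw [norm_smul, norm_inv, norm_norm, inv_mul_cancel₀ (norm_ne_zero_iff.mpr ha)]
  have hspan : (ℝ ∙ (‖a‖⁻¹ • a)) = (ℝ ∙ a) :=
    Submodule.span_singleton_smul_eq (IsUnit.mk0 _ (inv_ne_zero (norm_ne_zero_iff.mpr ha))) a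
  let T : ℝ ≃ₗᵢ[ℝ] ↥(ℝ ∙ a) :=
    (LinearIsometryEquiv.toSpanUnitSingleton (‖a‖⁻¹ • a) hâ).trans
      (LinearIsometryEquiv.ofEq _ _ hspan)
  let e : ℝ × ↥(ℝ ∙ a)ᗮ ≃ᵐ E :=
    (MeasurableEquiv.prodCongr T.toHomeomorph.toMeasurableEquiv (MeasurableEquiv.refl _)).trans
      ((MeasurableEquiv.toLp 2 (↥(ℝ ∙ a) × ↥(ℝ ∙ a)ᗮ)).trans
        (ℝ ∙ a).orthogonalDecomposition.symm.toHomeomorph.toMeasurableEquiv)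
  refine ⟨e, ?_, fun p => ?_⟩
  · have h1 : MeasurePreserving
        (MeasurableEquiv.prodCongr T.toHomeomorph.toMeasurableEquiv
          (MeasurableEquiv.refl ↥(ℝ ∙ a)ᗮ))
        ((volume : Measure ℝ).prod (volume : Measure ↥(ℝ ∙ a)ᗮ))
        ((volume : Measure ↥(ℝ ∙ a)).prod (volume : Measure ↥(ℝ ∙ a)ᗮ)) :=
      T.measurePreserving.prod (MeasurePreserving.id _)
    have h2 := WithLp.volume_preserving_toLp (↥(ℝ ∙ a)) (↥(ℝ ∙ a)ᗮ)
    have h3 := (ℝ ∙ a).orthogonalDecomposition.symm.measurePreserving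
    exact (h3.comp h2).comp h1
  · simp [e, T, MeasurableEquiv.prodCongr, MeasurableEquiv.trans_apply]

omit [FiniteDimensional ℝ E] [MeasurableSpace E] [BorelSpace E] in
/-- The coordinate along `a/|a|` of `t • a/|a| + b`, `b ⊥ a`, is `t`. [folklore] -/
theorem inner_unit_lineHyperplane {a : E} (ha : a ≠ 0) (p : ℝ × ↥(ℝ ∙ a)ᗮ) :
    ⟪‖a‖⁻¹ • a, p.1 • (‖a‖⁻¹ • a) + (p.2 : E)⟫_ℝ = p.1 := by
  have hb : ⟪a, (p.2 : E)⟫_ℝ = 0 :=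
    (Submodule.mem_orthogonal_singleton_iff_inner_right (𝕜 := ℝ)).mp p.2.2
  rw [inner_add_right, inner_smul_right, inner_smul_left,
    inner_smul_right, inner_smul_left, real_inner_self_eq_norm_sq, hb]
  simp only [RCLike.conj_to_real, mul_zero, add_zero]
  field_simp [norm_ne_zero_iff.mpr ha]

omit [FiniteDimensional ℝ E] [MeasurableSpace E] [BorelSpace E] in
/-- The hyperplane component of `t • a/|a| + b`, `b ⊥ a`, is `b`. [folklore] -/
theorem orthogonalProjectionOnto_lineHyperplane (a : E) (p : ℝ × ↥(ℝ ∙ a)ᗮ) :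
    (ℝ ∙ a)ᗮ.orthogonalProjectionOnto (p.1 • (‖a‖⁻¹ • a) + (p.2 : E)) = p.2 := by
  rw [map_add, Submodule.orthogonalProjectionOnto_mem_subspace_eq_self,
    Submodule.orthogonalProjectionOnto_orthogonal_apply_eq_zero, zero_add]
  exact Submodule.smul_mem _ _ (Submodule.smul_mem _ _ (Submodule.mem_span_singleton_self a))

omit [FiniteDimensional ℝ E] [MeasurableSpace E] [BorelSpace E] in
/-- Explicit formula for the orthogonal projection onto the hyperplane `(ℝ ∙ a)ᗮ`:
`P c = c − (⟪a, c⟫ / |a|²) a`. [folklore] -/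
theorem starProjection_orthogonal_span_singleton (a c : E) :
    (ℝ ∙ a)ᗮ.starProjection c = c - (⟪a, c⟫_ℝ / ‖a‖ ^ 2) • a := by
  rw [Submodule.starProjection_orthogonal_val, Submodule.starProjection_singleton]
  simp

omit [FiniteDimensional ℝ E] [MeasurableSpace E] [BorelSpace E] in
/-- On the slab `⟪a/|a|, c⟫ ∈ [0, 1]` one has `|c| ≤ 1 + |P c|` for the hyperplane projection
`P`. [folklore] -/
theorem norm_le_one_add_norm_starProjection_orthogonal {a c : E}
    (hc : ⟪‖a‖⁻¹ • a, c⟫_ℝ ∈ Icc (0 : ℝ) 1) :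
    ‖c‖ ≤ 1 + ‖(ℝ ∙ a)ᗮ.starProjection c‖ := by
  have hdecomp : c = (ℝ ∙ a).starProjection c + (ℝ ∙ a)ᗮ.starProjection c := by
    rw [Submodule.starProjection_orthogonal_val]; abel
  have hline : ‖(ℝ ∙ a).starProjection c‖ ≤ 1 := by
    rw [Submodule.starProjection_singleton, norm_smul, Real.norm_eq_abs]
    by_cases ha : a = 0
    · simp [ha]
    · have hna : 0 < ‖a‖ := norm_pos_iff.mpr ha
      rw [real_inner_smul_left] at hc
      simp only [RCLike.ofReal_real_eq_id, id_eq]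
      rw [abs_div, abs_of_pos (by positivity : (0 : ℝ) < ‖a‖ ^ 2)]
      have : |⟪a, c⟫_ℝ| ≤ ‖a‖ := by
        have h0 := hc.1; have h1 := hc.2
        rw [abs_le]
        constructor <;> nlinarith [mul_inv_cancel₀ hna.ne']
      calc |⟪a, c⟫_ℝ| / ‖a‖ ^ 2 * ‖a‖ = |⟪a, c⟫_ℝ| / ‖a‖ := by field_simp
        _ ≤ 1 := by rwa [div_le_one hna]
  calc ‖c‖ = ‖(ℝ ∙ a).starProjection c + (ℝ ∙ a)ᗮ.starProjection c‖ := by rw [← hdecomp]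
    _ ≤ ‖(ℝ ∙ a).starProjection c‖ + ‖(ℝ ∙ a)ᗮ.starProjection c‖ := norm_add_le _ _
    _ ≤ 1 + ‖(ℝ ∙ a)ᗮ.starProjection c‖ := by gcongr

/-- A hyperplane integral is a slab integral over the ambient space (Lebesgue version):
`∫_{(ℝ∙a)ᗮ} φ = ∫_E 1_{[0,1]}(⟪a/|a|, c⟫) φ(P c) dc`. [folklore] -/
theorem lintegral_hyperplane_eq_lintegral_slab {a : E} (ha : a ≠ 0) {φ : E → ℝ≥0∞}
    (hφ : Measurable φ) :
    ∫⁻ b : ↥(ℝ ∙ a)ᗮ, φ b =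
      ∫⁻ c : E, (Icc (0 : ℝ) 1).indicator (fun _ => (1 : ℝ≥0∞)) ⟪‖a‖⁻¹ • a, c⟫_ℝ *
        φ ((ℝ ∙ a)ᗮ.starProjection c) := by
  obtain ⟨e, he, he_apply⟩ := exists_lineHyperplane_measurableEquiv ha
  rw [← he.lintegral_comp_emb e.measurableEmbedding]
  simp_rw [he_apply, inner_unit_lineHyperplane ha, Submodule.starProjection_apply,
    orthogonalProjectionOnto_lineHyperplane]
  rw [lintegral_prod_mul (f := fun t : ℝ => (Icc (0 : ℝ) 1).indicator (fun _ => (1 : ℝ≥0∞)) t)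
    (g := fun b : ↥(ℝ ∙ a)ᗮ => φ b)
    ((measurable_const.indicator measurableSet_Icc).aemeasurable) (by fun_prop)]
  simp [lintegral_indicator, measurableSet_Icc]

/-- A hyperplane integral is a slab integral over the ambient space (Bochner version).
[folklore] -/
theorem integral_hyperplane_eq_integral_slab {a : E} (ha : a ≠ 0) (φ : E → ℝ) :
    ∫ b : ↥(ℝ ∙ a)ᗮ, φ b =
      ∫ c : E, (Icc (0 : ℝ) 1).indicator (fun _ => (1 : ℝ)) ⟪‖a‖⁻¹ • a, c⟫_ℝ *
        φ ((ℝ ∙ a)ᗮ.starProjection c) := by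
  obtain ⟨e, he, he_apply⟩ := exists_lineHyperplane_measurableEquiv ha
  rw [← he.integral_comp']
  simp_rw [he_apply, inner_unit_lineHyperplane ha, Submodule.starProjection_apply,
    orthogonalProjectionOnto_lineHyperplane]
  rw [integral_prod_mul (fun t : ℝ => (Icc (0 : ℝ) 1).indicator (fun _ => (1 : ℝ)) t)
    (fun b : ↥(ℝ ∙ a)ᗮ => φ b)]
  simp [integral_indicator, measurableSet_Icc]

/-- Measurability in parameters of the weighted hyperplane integrals
`x ↦ (2|v x|)⁻¹ ∫_{(ℝ ∙ v x)ᗮ} Φ(x, b) db` (Lebesgue version; the weight vanishes where `v x = 0`,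
where the hyperplane degenerates). [folklore] -/
theorem measurable_weight_mul_lintegral_hyperplane {α : Type*} [MeasurableSpace α]
    {v : α → E} (hv : Measurable v) {Φ : α → E → ℝ≥0∞}
    (hΦ : Measurable (Function.uncurry Φ)) :
    Measurable fun x => ENNReal.ofReal ((2 * ‖v x‖)⁻¹) * ∫⁻ b : ↥(ℝ ∙ v x)ᗮ, Φ x b := by
  have key : (fun x => ENNReal.ofReal ((2 * ‖v x‖)⁻¹) * ∫⁻ b : ↥(ℝ ∙ v x)ᗮ, Φ x b) = fun x =>
      ENNReal.ofReal ((2 * ‖v x‖)⁻¹) * ∫⁻ c : E,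
        (Icc (0 : ℝ) 1).indicator (fun _ => (1 : ℝ≥0∞)) ⟪‖v x‖⁻¹ • v x, c⟫_ℝ *
          Φ x (c - (⟪v x, c⟫_ℝ / ‖v x‖ ^ 2) • v x) := by
    ext x
    by_cases hx : v x = 0
    · simp [hx]
    · have hΦx : Measurable (Φ x) := hΦ.comp measurable_prodMk_left
      rw [lintegral_hyperplane_eq_lintegral_slab hx hΦx]
      simp_rw [starProjection_orthogonal_span_singleton]
  rw [key]
  refine Measurable.mul (by fun_prop) ?_
  refine Measurable.lintegral_prod_right' (f := fun q : α × E =>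
    (Icc (0 : ℝ) 1).indicator (fun _ => (1 : ℝ≥0∞)) ⟪‖v q.1‖⁻¹ • v q.1, q.2⟫_ℝ *
      Φ q.1 (q.2 - (⟪v q.1, q.2⟫_ℝ / ‖v q.1‖ ^ 2) • v q.1)) ?_
  have hm1 : Measurable fun q : α × E => ⟪‖v q.1‖⁻¹ • v q.1, q.2⟫_ℝ := by fun_prop
  have hm2 : Measurable fun q : α × E => q.2 - (⟪v q.1, q.2⟫_ℝ / ‖v q.1‖ ^ 2) • v q.1 := by
    fun_prop
  refine Measurable.mul ?_ ?_
  · exact ((measurable_const (a := (1 : ℝ≥0∞))).indicator measurableSet_Icc).comp hm1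
  · exact hΦ.comp (measurable_fst.prodMk hm2)

/-- Measurability in parameters of the weighted hyperplane integrals
`x ↦ (2|v x|)⁻¹ ∫_{(ℝ ∙ v x)ᗮ} Φ(x, b) db` (Bochner version). [folklore] -/
theorem stronglyMeasurable_weight_mul_integral_hyperplane {α : Type*} [MeasurableSpace α]
    {v : α → E} (hv : Measurable v) {Φ : α → E → ℝ}
    (hΦ : Measurable (Function.uncurry Φ)) :
    StronglyMeasurable fun x => (2 * ‖v x‖)⁻¹ * ∫ b : ↥(ℝ ∙ v x)ᗮ, Φ x b := by
  have key : (fun x => (2 * ‖v x‖)⁻¹ * ∫ b : ↥(ℝ ∙ v x)ᗮ, Φ x b) = fun x =>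
      (2 * ‖v x‖)⁻¹ * ∫ c : E,
        (Icc (0 : ℝ) 1).indicator (fun _ => (1 : ℝ)) ⟪‖v x‖⁻¹ • v x, c⟫_ℝ *
          Φ x (c - (⟪v x, c⟫_ℝ / ‖v x‖ ^ 2) • v x) := by
    ext x
    by_cases hx : v x = 0
    · simp [hx]
    · rw [integral_hyperplane_eq_integral_slab hx]
      simp_rw [starProjection_orthogonal_span_singleton]
  rw [key]
  refine Measurable.stronglyMeasurable (Measurable.mul (by fun_prop) ?_)
  refine (StronglyMeasurable.integral_prod_right' (f := fun q : α × E =>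
    (Icc (0 : ℝ) 1).indicator (fun _ => (1 : ℝ)) ⟪‖v q.1‖⁻¹ • v q.1, q.2⟫_ℝ *
      Φ q.1 (q.2 - (⟪v q.1, q.2⟫_ℝ / ‖v q.1‖ ^ 2) • v q.1)) ?_).measurable
  have hm1 : Measurable fun q : α × E => ⟪‖v q.1‖⁻¹ • v q.1, q.2⟫_ℝ := by fun_prop
  have hm2 : Measurable fun q : α × E => q.2 - (⟪v q.1, q.2⟫_ℝ / ‖v q.1‖ ^ 2) • v q.1 := by
    fun_prop
  refine Measurable.stronglyMeasurable (Measurable.mul ?_ ?_)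
  · exact ((measurable_const (a := (1 : ℝ))).indicator measurableSet_Icc).comp hm1
  · exact hΦ.comp (measurable_fst.prodMk hm2)

end Hyperplane

/-! ### 2.2 Weights: generic bounds and the bracket weight -/

section Weight

variable {β : E → ℝ≥0∞} {A : ℝ≥0∞}

omit [FiniteDimensional ℝ E] [MeasurableSpace E] [BorelSpace E] in
/-- For orthogonal `a`, `b`: `|a|, |b| ≤ |a + b|` and `|a|, |b| ≤ |a - b|`. [folklore] -/
theorem norm_le_of_inner_eq_zero {a b : E} (h : ⟪a, b⟫_ℝ = 0) :
    ‖a‖ ≤ ‖a + b‖ ∧ ‖b‖ ≤ ‖a + b‖ ∧ ‖a‖ ≤ ‖a - b‖ ∧ ‖b‖ ≤ ‖a - b‖ := by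
  have h1 := norm_add_sq_eq_norm_sq_add_norm_sq_real h
  have h2 := norm_sub_sq_eq_norm_sq_add_norm_sq_real h
  have ha := norm_nonneg a; have hb := norm_nonneg b
  have hab := norm_nonneg (a + b); have hab' := norm_nonneg (a - b)
  refine ⟨?_, ?_, ?_, ?_⟩ <;> nlinarith

/-- **Two-point bound** for a measurable weight `β` with `β x ≤ A β y` whenever
`|y| ≤ 1 + 2|x|`: `∫ β(k+u) β(k+w) dk ≤ A · 2C₀ · β(u−w)`, `C₀ = ∫ β` (case distinction on which
of `k+u`, `k+w` is at distance `≥ |u−w|/2`; translation invariance). [folklore] -/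
theorem lintegral_weight2_le (hβm : Measurable β)
    (hβ2 : ∀ x y : E, ‖y‖ ≤ 1 + 2 * ‖x‖ → β x ≤ A * β y) (u w : E) :
    ∫⁻ k, β (k + u) * β (k + w) ≤ A * (2 * ∫⁻ k, β k) * β (u - w) := by
  have hpt : ∀ k, β (k + u) * β (k + w) ≤ A * β (u - w) * (β (k + u) + β (k + w)) := by
    intro k
    have htri : ‖u - w‖ ≤ ‖k + u‖ + ‖k + w‖ := by
      calc ‖u - w‖ = ‖(k + u) - (k + w)‖ := by congr 1; abel
        _ ≤ ‖k + u‖ + ‖k + w‖ := norm_sub_le _ _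
    by_cases hc : ‖u - w‖ ≤ 2 * ‖k + u‖
    · calc β (k + u) * β (k + w)
          ≤ (A * β (u - w)) * β (k + w) := by
            gcongr; exact hβ2 _ _ (hc.trans (by linarith [norm_nonneg (k + u)]))
        _ ≤ _ := by gcongr; exact le_add_self
    · have hc' : ‖u - w‖ ≤ 1 + 2 * ‖k + w‖ := by linarith [not_le.mp hc]
      calc β (k + u) * β (k + w)
          ≤ β (k + u) * (A * β (u - w)) := by gcongr; exact hβ2 _ _ hc'
        _ = (A * β (u - w)) * β (k + u) := by ring
        _ ≤ _ := by gcongr; exact le_self_add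
  calc ∫⁻ k, β (k + u) * β (k + w)
      ≤ ∫⁻ k, A * β (u - w) * (β (k + u) + β (k + w)) := lintegral_mono hpt
    _ = A * β (u - w) * ((∫⁻ k, β (k + u)) + ∫⁻ k, β (k + w)) := by
        rw [lintegral_const_mul _ (by fun_prop), lintegral_add_left (by fun_prop)]
    _ = A * (2 * ∫⁻ k, β k) * β (u - w) := by
        rw [lintegral_add_right_eq_self (fun k => β k) u,
          lintegral_add_right_eq_self (fun k => β k) w]
        ring

/-- **Three-point bound**: if `|y₁|, |y₂| ≤ |p − r|` then
`∫ β(k+p) β(k+q) β(k+r) dk ≤ A C_TP (β(y₁) β(q−r) + β(y₂) β(p−q))`, `C_TP = A · 2C₀`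
(case distinction on whether `k + p` is at distance `≥ |p − r|/2`, then the two-point bound).
[folklore] -/
theorem lintegral_weight3_le (hβm : Measurable β)
    (hβ2 : ∀ x y : E, ‖y‖ ≤ 1 + 2 * ‖x‖ → β x ≤ A * β y) {p q r y₁ y₂ : E}
    (h₁ : ‖y₁‖ ≤ ‖p - r‖) (h₂ : ‖y₂‖ ≤ ‖p - r‖) :
    ∫⁻ k, β (k + p) * β (k + q) * β (k + r) ≤
      A * (A * (2 * ∫⁻ k, β k)) * (β y₁ * β (q - r) + β y₂ * β (p - q)) := by
  set CTP := A * (2 * ∫⁻ k, β k)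
  have hpt : ∀ k, β (k + p) * β (k + q) * β (k + r) ≤
      A * β y₁ * (β (k + q) * β (k + r)) + A * β y₂ * (β (k + p) * β (k + q)) := by
    intro k
    have htri : ‖p - r‖ ≤ ‖k + p‖ + ‖k + r‖ := by
      calc ‖p - r‖ = ‖(k + p) - (k + r)‖ := by congr 1; abel
        _ ≤ ‖k + p‖ + ‖k + r‖ := norm_sub_le _ _
    by_cases hc : ‖p - r‖ ≤ 2 * ‖k + p‖
    · have : β (k + p) ≤ A * β y₁ :=
        hβ2 _ _ ((h₁.trans hc).trans (by linarith [norm_nonneg (k + p)]))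
      calc β (k + p) * β (k + q) * β (k + r)
          = β (k + p) * (β (k + q) * β (k + r)) := by ring
        _ ≤ A * β y₁ * (β (k + q) * β (k + r)) := by gcongr
        _ ≤ _ := le_self_add
    · have hc' : ‖y₂‖ ≤ 1 + 2 * ‖k + r‖ := by linarith [not_le.mp hc]
      have : β (k + r) ≤ A * β y₂ := hβ2 _ _ hc'
      calc β (k + p) * β (k + q) * β (k + r)
          ≤ β (k + p) * β (k + q) * (A * β y₂) := by gcongr
        _ = A * β y₂ * (β (k + p) * β (k + q)) := by ring
        _ ≤ _ := le_add_self
  calc ∫⁻ k, β (k + p) * β (k + q) * β (k + r)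
      ≤ ∫⁻ k, A * β y₁ * (β (k + q) * β (k + r)) + A * β y₂ * (β (k + p) * β (k + q)) :=
        lintegral_mono hpt
    _ = (A * β y₁ * ∫⁻ k, β (k + q) * β (k + r)) + A * β y₂ * ∫⁻ k, β (k + p) * β (k + q) := by
        rw [lintegral_add_left (by fun_prop), lintegral_const_mul _ (by fun_prop),
          lintegral_const_mul _ (by fun_prop)]
    _ ≤ A * β y₁ * (CTP * β (q - r)) + A * β y₂ * (CTP * β (p - q)) := by
        gcongr
        · exact lintegral_weight2_le hβm hβ2 q r
        · exact lintegral_weight2_le hβm hβ2 p q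
    _ = A * CTP * (β y₁ * β (q - r) + β y₂ * β (p - q)) := by ring

/-- **Uniform hyperplane bound**: `∫_{(ℝ∙a)ᗮ} β ≤ A ∫_E β` for `a ≠ 0` (slab representation and
`|c| ≤ 1 + |P c|` on the slab). [folklore] -/
theorem lintegral_hyperplane_weight_le (hβm : Measurable β)
    (hβ2 : ∀ x y : E, ‖y‖ ≤ 1 + 2 * ‖x‖ → β x ≤ A * β y) {a : E} (ha : a ≠ 0) :
    ∫⁻ b : ↥(ℝ ∙ a)ᗮ, β b ≤ A * ∫⁻ c : E, β c := by
  rw [lintegral_hyperplane_eq_lintegral_slab ha hβm, ← lintegral_const_mul _ hβm]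
  refine lintegral_mono fun c => ?_
  by_cases hc : ⟪‖a‖⁻¹ • a, c⟫_ℝ ∈ Icc (0 : ℝ) 1
  · rw [indicator_of_mem hc, one_mul]
    refine hβ2 _ _ ?_
    linarith [norm_le_one_add_norm_starProjection_orthogonal hc,
      norm_nonneg ((ℝ ∙ a)ᗮ.starProjection c)]
  · rw [indicator_of_notMem hc, zero_mul]; exact zero_le

omit [InnerProductSpace ℝ E] [FiniteDimensional ℝ E] [MeasurableSpace E] [BorelSpace E] in
/-- The bracket weight `⟨x⟩^{-s} = (1 + |x|)^{-s}` satisfies `⟨x⟩^{-s} ≤ 2^s ⟨y⟩^{-s}` whenever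
`|y| ≤ 1 + 2|x|` (`s ≥ 0`). [folklore] -/
theorem bracket_le_of_norm_le {s : ℝ} (hs : 0 ≤ s) {x y : E} (h : ‖y‖ ≤ 1 + 2 * ‖x‖) :
    ENNReal.ofReal ((1 + ‖x‖) ^ (-s)) ≤
      ENNReal.ofReal (2 ^ s) * ENNReal.ofReal ((1 + ‖y‖) ^ (-s)) := by
  rw [← ENNReal.ofReal_mul (by positivity)]
  refine ENNReal.ofReal_le_ofReal ?_
  have hx : 0 < 1 + ‖x‖ := by positivity
  have hy : 0 < 1 + ‖y‖ := by positivity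
  have h1 : (2 * (1 + ‖x‖)) ^ (-s) ≤ (1 + ‖y‖) ^ (-s) :=
    Real.rpow_le_rpow_of_nonpos hy (by linarith) (by linarith)
  rw [Real.mul_rpow (by norm_num) hx.le] at h1
  have h2 : (2 : ℝ) ^ s * (2 : ℝ) ^ (-s) = 1 := by
    rw [← Real.rpow_add (by norm_num)]; simp
  calc (1 + ‖x‖) ^ (-s) = 2 ^ s * ((2 : ℝ) ^ (-s) * (1 + ‖x‖) ^ (-s)) := by
        rw [← mul_assoc, h2, one_mul]
    _ ≤ 2 ^ s * (1 + ‖y‖) ^ (-s) := by gcongr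

/-- **Local integrability of the weight**: `a ↦ (2|a|)⁻¹ ⟨a⟩^{-s}` is integrable on `E` when
`2 ≤ dim E < s` (polar coordinates: `r^{d-1} · (2r)⁻¹ ⟨r⟩^{-s} ≤ ½ ⟨r⟩^{d-2-s}` is integrable on
`(0, ∞)`; Mathlib's `integrable_fun_norm_addHaar`). [folklore] -/
theorem integrable_weight_mul_rpow {s : ℝ} (hE : 2 ≤ finrank ℝ E) (hs : (finrank ℝ E : ℝ) < s) :
    Integrable (fun a : E => (2 * ‖a‖)⁻¹ * (1 + ‖a‖) ^ (-s)) := by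
  have : Nontrivial E := Module.nontrivial_of_finrank_pos (R := ℝ) (by omega)
  have h := (integrable_fun_norm_addHaar (volume : Measure E)
    (f := fun y : ℝ => (2 * y)⁻¹ * (1 + y) ^ (-s))).mpr ?_
  · simpa using h
  -- integrability on `(0, ∞)` of `y^{d-1} (2y)⁻¹ (1+y)^{-s} ≤ (1/2) (1+|y|)^{-(s-d+2)}`
  have hr : (finrank ℝ ℝ : ℝ) < s - (finrank ℝ E : ℝ) + 2 := by simp; linarith
  have hint : Integrable (fun y : ℝ => (1 + ‖y‖) ^ (-(s - (finrank ℝ E : ℝ) + 2))) :=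
    integrable_one_add_norm hr
  refine ((hint.const_mul (2⁻¹ : ℝ)).integrableOn (s := Ioi 0)).mono' ?_ ?_
  · refine (Measurable.aestronglyMeasurable ?_).restrict
    fun_prop
  · refine (ae_restrict_mem measurableSet_Ioi).mono fun y (hy : 0 < y) => ?_
    have hy1 : 0 < 1 + y := by linarith
    rw [Real.norm_eq_abs, abs_of_nonneg (by positivity), Real.norm_eq_abs, abs_of_pos hy,
      smul_eq_mul]
    have hd : (y : ℝ) ^ (finrank ℝ E - 1) * (2 * y)⁻¹ = 2⁻¹ * y ^ ((finrank ℝ E : ℝ) - 2) := by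
      rw [← Real.rpow_natCast, Nat.cast_sub (by omega), mul_inv, Nat.cast_one]
      rw [show (finrank ℝ E : ℝ) - 2 = ((finrank ℝ E : ℝ) - 1) + (-1) by ring,
        Real.rpow_add hy, Real.rpow_neg_one]
      ring
    rw [← mul_assoc, hd]
    have hpow : y ^ ((finrank ℝ E : ℝ) - 2) ≤ (1 + y) ^ ((finrank ℝ E : ℝ) - 2) :=
      Real.rpow_le_rpow hy.le (by linarith) (by
        have : (2 : ℝ) ≤ finrank ℝ E := by exact_mod_cast hE
        linarith)
    calc 2⁻¹ * y ^ ((finrank ℝ E : ℝ) - 2) * (1 + y) ^ (-s)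
        ≤ 2⁻¹ * (1 + y) ^ ((finrank ℝ E : ℝ) - 2) * (1 + y) ^ (-s) := by gcongr
      _ = 2⁻¹ * (1 + y) ^ (-(s - (finrank ℝ E : ℝ) + 2)) := by
        rw [mul_assoc, ← Real.rpow_add hy1]; ring_nf

/-- The weight `(2|a|)⁻¹ ⟨a⟩^{-s}` has finite Lebesgue integral (`2 ≤ dim E < s`). [folklore] -/
theorem lintegral_weight_mul_bracket_lt_top {s : ℝ} (hE : 2 ≤ finrank ℝ E)
    (hs : (finrank ℝ E : ℝ) < s) :
    ∫⁻ a : E, ENNReal.ofReal ((2 * ‖a‖)⁻¹) * ENNReal.ofReal ((1 + ‖a‖) ^ (-s)) < ⊤ := by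
  have h := (integrable_weight_mul_rpow hE hs).hasFiniteIntegral
  rw [hasFiniteIntegral_iff_enorm] at h
  refine lt_of_le_of_lt (le_of_eq ?_) h
  refine lintegral_congr fun a => ?_
  rw [← ENNReal.ofReal_mul (by positivity), Real.enorm_eq_ofReal (by positivity)]

end Weight

/-! ### 2.3 The majorant of the collision integrand -/

section Majorant

variable {β : E → ℝ≥0∞} {A : ℝ≥0∞}

omit [NormedAddCommGroup E] [InnerProductSpace ℝ E] [FiniteDimensional ℝ E] [MeasurableSpace E]
  [BorelSpace E] in
/-- **Pointwise bound**: `‖m‖ ≤ c β` implies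
`‖cubicForm m k k₁ k₂ k₃‖ ≤ c³ (β₁β₂β₃ + β β₂β₃ + β β₁β₃ + β β₁β₂)`. [folklore] -/
theorem enorm_cubicForm_le {m : E → ℝ} {c : ℝ≥0∞} (hdec : ∀ x, ‖m x‖ₑ ≤ c * β x)
    (k k₁ k₂ k₃ : E) :
    ‖cubicForm m k k₁ k₂ k₃‖ₑ ≤ c ^ 3 *
      (β k₁ * β k₂ * β k₃ + β k * β k₂ * β k₃ + β k * β k₁ * β k₃ + β k * β k₁ * β k₂) := by
  have h3 : ∀ x y z, ‖m x * m y * m z‖ₑ ≤ c ^ 3 * (β x * β y * β z) := by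
    intro x y z
    rw [enorm_mul, enorm_mul]
    calc ‖m x‖ₑ * ‖m y‖ₑ * ‖m z‖ₑ ≤ (c * β x) * (c * β y) * (c * β z) := by
          gcongr <;> apply hdec
      _ = c ^ 3 * (β x * β y * β z) := by ring
  have hsub : ∀ u v : ℝ, ‖u - v‖ₑ ≤ ‖u‖ₑ + ‖v‖ₑ := fun u v => by
    simpa [sub_eq_add_neg] using enorm_add_le u (-v)
  unfold cubicForm
  calc ‖m k₁ * m k₂ * m k₃ - m k * m k₂ * m k₃ + m k * m k₁ * m k₃ - m k * m k₁ * m k₂‖ₑ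
      ≤ ‖m k₁ * m k₂ * m k₃‖ₑ + ‖m k * m k₂ * m k₃‖ₑ + ‖m k * m k₁ * m k₃‖ₑ +
          ‖m k * m k₁ * m k₂‖ₑ := by
        refine (hsub _ _).trans ?_
        gcongr
        refine (enorm_add_le _ _).trans ?_
        gcongr
        exact hsub _ _
    _ ≤ c ^ 3 * (β k₁ * β k₂ * β k₃) + c ^ 3 * (β k * β k₂ * β k₃) +
          c ^ 3 * (β k * β k₁ * β k₃) + c ^ 3 * (β k * β k₁ * β k₂) := by
        gcongr <;> apply h3
    _ = _ := by ring

/-- **Integrated majorant bound** on the resonant manifold (`b ⊥ a`): for a symmetric weight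
with the doubling-type property, `∫_k Σ β β β dk ≤ 8 K₃ β(a) β(b)`, `K₃ = A · A · 2C₀`
(three-point bound for each of the four terms; the far pair is at distance `|a ± b| ≥ |a|, |b|`).
[folklore] -/
theorem lintegral_sum3_le (hβm : Measurable β)
    (hβ2 : ∀ x y : E, ‖y‖ ≤ 1 + 2 * ‖x‖ → β x ≤ A * β y) (hβneg : ∀ x, β (-x) = β x)
    {a b : E} (hab : ⟪a, b⟫_ℝ = 0) :
    ∫⁻ k, (β (k + a) * β (k + a + b) * β (k + b) + β k * β (k + a + b) * β (k + b) +
        β k * β (k + a) * β (k + b) + β k * β (k + a) * β (k + a + b)) ≤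
      8 * (A * (A * (2 * ∫⁻ k, β k))) * (β a * β b) := by
  set K := A * (A * (2 * ∫⁻ k, β k))
  obtain ⟨ha_add, hb_add, ha_sub, hb_sub⟩ := norm_le_of_inner_eq_zero hab
  -- term 1: p = a, q = a + b, r = b
  have t1 : ∫⁻ k, β (k + a) * β (k + a + b) * β (k + b) ≤ K * (2 * (β a * β b)) := by
    have := lintegral_weight3_le hβm hβ2 (p := a) (q := a + b) (r := b) (y₁ := b) (y₂ := a)
      hb_sub ha_sub
    simp only [add_sub_cancel_right, sub_add_cancel_left, hβneg, add_assoc] at this ⊢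
    calc _ ≤ _ := this
      _ = _ := by ring
  -- term 2: p = 0, q = b, r = a + b
  have t2 : ∫⁻ k, β k * β (k + a + b) * β (k + b) ≤ K * (2 * (β a * β b)) := by
    have := lintegral_weight3_le hβm hβ2 (p := 0) (q := b) (r := a + b) (y₁ := b) (y₂ := a)
      (by rwa [zero_sub, norm_neg]) (by rwa [zero_sub, norm_neg])
    simp only [add_zero, zero_sub, hβneg, sub_add_cancel_right] at this
    calc ∫⁻ k, β k * β (k + a + b) * β (k + b)
        = ∫⁻ k, β k * β (k + b) * β (k + (a + b)) := by
          congr 1; ext k; rw [add_assoc]; ring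
      _ ≤ _ := this
      _ = _ := by ring
  -- term 3: p = a, q = 0, r = b
  have t3 : ∫⁻ k, β k * β (k + a) * β (k + b) ≤ K * (2 * (β a * β b)) := by
    have := lintegral_weight3_le hβm hβ2 (p := a) (q := 0) (r := b) (y₁ := a) (y₂ := b)
      ha_sub hb_sub
    simp only [add_zero, zero_sub, hβneg, sub_zero] at this
    calc ∫⁻ k, β k * β (k + a) * β (k + b)
        = ∫⁻ k, β (k + a) * β k * β (k + b) := by
          congr 1; ext k; ring
      _ ≤ _ := this
      _ = _ := by ring
  -- term 4: p = 0, q = a, r = a + b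
  have t4 : ∫⁻ k, β k * β (k + a) * β (k + a + b) ≤ K * (2 * (β a * β b)) := by
    have := lintegral_weight3_le hβm hβ2 (p := 0) (q := a) (r := a + b) (y₁ := a) (y₂ := b)
      (by rwa [zero_sub, norm_neg]) (by rwa [zero_sub, norm_neg])
    simp only [add_zero, zero_sub, hβneg, sub_add_cancel_left] at this
    calc ∫⁻ k, β k * β (k + a) * β (k + a + b)
        = ∫⁻ k, β k * β (k + a) * β (k + (a + b)) := by
          simp_rw [add_assoc]
      _ ≤ _ := this
      _ = _ := by ring
  calc ∫⁻ k, (β (k + a) * β (k + a + b) * β (k + b) + β k * β (k + a + b) * β (k + b) +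
        β k * β (k + a) * β (k + b) + β k * β (k + a) * β (k + a + b))
      = (((∫⁻ k, β (k + a) * β (k + a + b) * β (k + b)) +
          ∫⁻ k, β k * β (k + a + b) * β (k + b)) +
          ∫⁻ k, β k * β (k + a) * β (k + b)) +
          ∫⁻ k, β k * β (k + a) * β (k + a + b) := by
        rw [lintegral_add_left (by fun_prop), lintegral_add_left (by fun_prop),
          lintegral_add_left (by fun_prop)]
    _ ≤ K * (2 * (β a * β b)) + K * (2 * (β a * β b)) + K * (2 * (β a * β b)) +
          K * (2 * (β a * β b)) := by gcongr
    _ = 8 * K * (β a * β b) := by ring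

/-- **Finiteness of the integrated majorant**: if moreover `A, C₀ = ∫ β` are finite and the
weight `(2|a|)⁻¹ β(a)` is integrable, then
`∫_k ∫_a (2|a|)⁻¹ ∫_{(ℝ∙a)ᗮ} Σ β β β db da dk < ∞` (Tonelli, integrating `k` first, then the
uniform hyperplane bound). [folklore] -/
theorem lintegral_weight_sum3_lt_top (hβm : Measurable β)
    (hβ2 : ∀ x y : E, ‖y‖ ≤ 1 + 2 * ‖x‖ → β x ≤ A * β y) (hβneg : ∀ x, β (-x) = β x)
    (hA : A ≠ ⊤) (hC₀ : ∫⁻ k, β k ≠ ⊤)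
    (hW : ∫⁻ a : E, ENNReal.ofReal ((2 * ‖a‖)⁻¹) * β a < ⊤) :
    ∫⁻ k : E, ∫⁻ a : E, ENNReal.ofReal ((2 * ‖a‖)⁻¹) * ∫⁻ b : ↥(ℝ ∙ a)ᗮ,
      (β (k + a) * β (k + a + b) * β (k + b) + β k * β (k + a + b) * β (k + b) +
        β k * β (k + a) * β (k + b) + β k * β (k + a) * β (k + a + b)) < ⊤ := by
  set C₀ := ∫⁻ k, β k
  set K := A * (A * (2 * C₀))
  -- the integrand as a function of `(k, a, b)`
  set S : E → E → E → ℝ≥0∞ := fun k a b =>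
    β (k + a) * β (k + a + b) * β (k + b) + β k * β (k + a + b) * β (k + b) +
      β k * β (k + a) * β (k + b) + β k * β (k + a) * β (k + a + b) with hS
  have hSm : Measurable fun q : (E × E) × E => S q.1.1 q.1.2 q.2 := by
    simp only [hS]; fun_prop
  have hmeasG : Measurable fun p : E × E =>
      ENNReal.ofReal ((2 * ‖p.2‖)⁻¹) * ∫⁻ b : ↥(ℝ ∙ p.2)ᗮ, S p.1 p.2 b :=
    measurable_weight_mul_lintegral_hyperplane measurable_snd (Φ := fun p b => S p.1 p.2 b) hSm
  change ∫⁻ k : E, ∫⁻ a : E, ENNReal.ofReal ((2 * ‖a‖)⁻¹) * ∫⁻ b : ↥(ℝ ∙ a)ᗮ, S k a b < ⊤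
  rw [lintegral_lintegral_swap hmeasG.aemeasurable]
  have step : ∀ a : E, ∫⁻ k : E, ENNReal.ofReal ((2 * ‖a‖)⁻¹) *
      ∫⁻ b : ↥(ℝ ∙ a)ᗮ, S k a b ≤
        ENNReal.ofReal ((2 * ‖a‖)⁻¹) * β a * (8 * K * (A * C₀)) := by
    intro a
    have hSa : Measurable fun q : E × ↥(ℝ ∙ a)ᗮ => S q.1 a q.2 := by
      simp only [hS]; fun_prop
    rw [lintegral_const_mul _ hSa.lintegral_prod_right', mul_assoc]
    by_cases ha : a = 0
    · simp [ha]
    gcongr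
    calc ∫⁻ k : E, ∫⁻ b : ↥(ℝ ∙ a)ᗮ, S k a b
        = ∫⁻ b : ↥(ℝ ∙ a)ᗮ, ∫⁻ k : E, S k a b := lintegral_lintegral_swap hSa.aemeasurable
      _ ≤ ∫⁻ b : ↥(ℝ ∙ a)ᗮ, 8 * K * (β a * β b) :=
          lintegral_mono fun b => lintegral_sum3_le hβm hβ2 hβneg
            ((Submodule.mem_orthogonal_singleton_iff_inner_right (𝕜 := ℝ)).mp b.2)
      _ = 8 * K * β a * ∫⁻ b : ↥(ℝ ∙ a)ᗮ, β b := by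
          rw [← lintegral_const_mul (8 * K * β a)
            (show Measurable (fun b : ↥(ℝ ∙ a)ᗮ => β (b : E)) from
              hβm.comp measurable_subtype_coe)]
          congr 1; ext b; ring
      _ ≤ 8 * K * β a * (A * C₀) := by
          gcongr; exact lintegral_hyperplane_weight_le hβm hβ2 ha
      _ = β a * (8 * K * (A * C₀)) := by ring
  calc ∫⁻ a : E, ∫⁻ k : E, ENNReal.ofReal ((2 * ‖a‖)⁻¹) * ∫⁻ b : ↥(ℝ ∙ a)ᗮ, S k a b
      ≤ ∫⁻ a : E, ENNReal.ofReal ((2 * ‖a‖)⁻¹) * β a * (8 * K * (A * C₀)) :=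
        lintegral_mono step
    _ = (∫⁻ a : E, ENNReal.ofReal ((2 * ‖a‖)⁻¹) * β a) * (8 * K * (A * C₀)) := by
        rw [lintegral_mul_const _ (by fun_prop)]
    _ < ⊤ := by
        refine ENNReal.mul_lt_top hW ?_
        have hA' : A < ⊤ := hA.lt_top
        have hC₀' : C₀ < ⊤ := hC₀.lt_top
        have hK : K < ⊤ := ENNReal.mul_lt_top hA' (ENNReal.mul_lt_top hA'
          (ENNReal.mul_lt_top (by simp) hC₀'))
        exact ENNReal.mul_lt_top (ENNReal.mul_lt_top (by simp) hK) (ENNReal.mul_lt_top hA' hC₀')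

/-- Pulling a constant out of the iterated weighted hyperplane integral of the majorant.
[folklore] -/
theorem lintegral_weight_const_mul_sum3 (hβm : Measurable β) (c : ℝ≥0∞) :
    ∫⁻ k : E, ∫⁻ a : E, ENNReal.ofReal ((2 * ‖a‖)⁻¹) * ∫⁻ b : ↥(ℝ ∙ a)ᗮ, c *
        (β (k + a) * β (k + a + b) * β (k + b) + β k * β (k + a + b) * β (k + b) +
          β k * β (k + a) * β (k + b) + β k * β (k + a) * β (k + a + b)) =
      c * ∫⁻ k : E, ∫⁻ a : E, ENNReal.ofReal ((2 * ‖a‖)⁻¹) * ∫⁻ b : ↥(ℝ ∙ a)ᗮ,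
        (β (k + a) * β (k + a + b) * β (k + b) + β k * β (k + a + b) * β (k + b) +
          β k * β (k + a) * β (k + b) + β k * β (k + a) * β (k + a + b)) := by
  set S : E → E → E → ℝ≥0∞ := fun k a b =>
    β (k + a) * β (k + a + b) * β (k + b) + β k * β (k + a + b) * β (k + b) +
      β k * β (k + a) * β (k + b) + β k * β (k + a) * β (k + a + b) with hS
  have hSm : Measurable fun q : (E × E) × E => S q.1.1 q.1.2 q.2 := by
    simp only [hS]; fun_prop
  have hWm : Measurable fun p : E × E => ENNReal.ofReal ((2 * ‖p.2‖)⁻¹) *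
      ∫⁻ b : ↥(ℝ ∙ p.2)ᗮ, S p.1 p.2 b :=
    measurable_weight_mul_lintegral_hyperplane measurable_snd (Φ := fun p b => S p.1 p.2 b) hSm
  have hWk : ∀ k : E, Measurable fun a : E => ENNReal.ofReal ((2 * ‖a‖)⁻¹) *
      ∫⁻ b : ↥(ℝ ∙ a)ᗮ, S k a b := fun k => hWm.comp measurable_prodMk_left
  change ∫⁻ k : E, ∫⁻ a : E, ENNReal.ofReal ((2 * ‖a‖)⁻¹) * ∫⁻ b : ↥(ℝ ∙ a)ᗮ, c * S k a b =
    c * ∫⁻ k : E, ∫⁻ a : E, ENNReal.ofReal ((2 * ‖a‖)⁻¹) * ∫⁻ b : ↥(ℝ ∙ a)ᗮ, S k a b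
  have h1 : ∀ k a : E, ENNReal.ofReal ((2 * ‖a‖)⁻¹) * ∫⁻ b : ↥(ℝ ∙ a)ᗮ, c * S k a b =
      c * (ENNReal.ofReal ((2 * ‖a‖)⁻¹) * ∫⁻ b : ↥(ℝ ∙ a)ᗮ, S k a b) := by
    intro k a
    have hSka : Measurable fun b : ↥(ℝ ∙ a)ᗮ => S k a b := by simp only [hS]; fun_prop
    rw [lintegral_const_mul _ hSka]
    ring
  simp_rw [h1]
  rw [← lintegral_const_mul _ hWm.lintegral_prod_right']
  congr 1; ext k
  rw [lintegral_const_mul _ (hWk k)]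

/-- **The majorant of the collision term**: if `‖m‖ ≤ c β` then
`‖collision m k‖ ≤ g(k) := ∫_a (2|a|)⁻¹ ∫_{(ℝ∙a)ᗮ} c³ Σ β β β`. [folklore] -/
theorem enorm_collision_le {m : E → ℝ} {c : ℝ≥0∞} (hdec : ∀ x, ‖m x‖ₑ ≤ c * β x) (k : E) :
    ‖collision m k‖ₑ ≤ ∫⁻ a : E, ENNReal.ofReal ((2 * ‖a‖)⁻¹) * ∫⁻ b : ↥(ℝ ∙ a)ᗮ, c ^ 3 *
      (β (k + a) * β (k + a + b) * β (k + b) + β k * β (k + a + b) * β (k + b) +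
        β k * β (k + a) * β (k + b) + β k * β (k + a) * β (k + a + b)) := by
  unfold collision
  refine (enorm_integral_le_lintegral_enorm _).trans (lintegral_mono fun a => ?_)
  rw [enorm_mul, Real.enorm_eq_ofReal (by positivity)]
  gcongr
  exact (enorm_integral_le_lintegral_enorm _).trans
    (lintegral_mono fun b => enorm_cubicForm_le hdec _ _ _ _)

/-- The majorant `g` is measurable in `k`. [folklore] -/
theorem measurable_majorant (hβm : Measurable β) (c : ℝ≥0∞) :
    Measurable fun k : E => ∫⁻ a : E, ENNReal.ofReal ((2 * ‖a‖)⁻¹) * ∫⁻ b : ↥(ℝ ∙ a)ᗮ, c *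
      (β (k + a) * β (k + a + b) * β (k + b) + β k * β (k + a + b) * β (k + b) +
        β k * β (k + a) * β (k + b) + β k * β (k + a) * β (k + a + b)) :=
  (measurable_weight_mul_lintegral_hyperplane measurable_snd
    (Φ := fun (p : E × E) b => c * (β (p.1 + p.2) * β (p.1 + p.2 + b) * β (p.1 + b) +
      β p.1 * β (p.1 + p.2 + b) * β (p.1 + b) + β p.1 * β (p.1 + p.2) * β (p.1 + b) +
      β p.1 * β (p.1 + p.2) * β (p.1 + p.2 + b))) (by fun_prop)).lintegral_prod_right'

end Majorant

/-! ### 2.4 The collision integral has zero mean -/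

section Vanishing

/-- Transport of a hyperplane integral along an equality of lines. [folklore] -/
theorem integral_orthogonal_congr {K K' : Submodule ℝ E} (h : K = K') (f : E → ℝ) :
    ∫ b : ↥Kᗮ, f b = ∫ b : ↥K'ᗮ, f b := by
  subst h; rfl

/-- Joint measurability of the collision integrand in `((k, a), b)`. [folklore] -/
theorem measurable_cubicForm_param {m : E → ℝ} (hm : Measurable m) :
    Measurable (Function.uncurry fun (p : E × E) (b : E) =>
      cubicForm m p.1 (p.1 + p.2) (p.1 + p.2 + b) (p.1 + b)) := by
  unfold cubicForm Function.uncurry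
  fun_prop

omit [InnerProductSpace ℝ E] [FiniteDimensional ℝ E] [MeasurableSpace E] [BorelSpace E] in
/-- The decay hypothesis `|m| ≤ C ⟨·⟩^{-s}` in extended-nonnegative form. [folklore] -/
theorem enorm_le_of_decay {s C : ℝ} {m : E → ℝ} (hdec : ∀ x, |m x| ≤ C * (1 + ‖x‖) ^ (-s))
    (x : E) : ‖m x‖ₑ ≤ ENNReal.ofReal C * ENNReal.ofReal ((1 + ‖x‖) ^ (-s)) := by
  have hC : 0 ≤ C := by
    have := (abs_nonneg _).trans (hdec 0)
    simpa using this
  rw [Real.enorm_eq_ofReal_abs, ← ENNReal.ofReal_mul hC]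
  exact ENNReal.ofReal_le_ofReal (hdec x)

/-- **Vanishing of the integrated collision term** `∫ 𝒦(m)(k) dk = 0` for measurable
`|m| ≤ C ⟨·⟩^{-s}`, `2 ≤ dim E < s`: Fubini in `(k, a)` (absolute convergence by the majorant),
`a ↦ −a`, `k ↦ k + a`, and the pointwise antisymmetry of `cubicForm` (Nazarenko 2011,
(8.18)–(8.19) with `ρ ≡ 1`).
[cite: Nazarenko2011, §8.1.3 (8.18)–(8.22)] -/
theorem integral_collision_eq_zero {s C : ℝ} (hE : 2 ≤ finrank ℝ E) (hs : (finrank ℝ E : ℝ) < s)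
    {m : E → ℝ} (hm : Measurable m) (hdec : ∀ x, |m x| ≤ C * (1 + ‖x‖) ^ (-s)) :
    ∫ k, collision m k = 0 := by
  have hs0 : 0 ≤ s := le_trans (Nat.cast_nonneg _) hs.le
  -- the bracket weight and its properties
  set β : E → ℝ≥0∞ := fun x => ENNReal.ofReal ((1 + ‖x‖) ^ (-s)) with hβ
  have hβm : Measurable β := by rw [hβ]; fun_prop
  have hβ2 : ∀ x y : E, ‖y‖ ≤ 1 + 2 * ‖x‖ → β x ≤ ENNReal.ofReal (2 ^ s) * β y :=
    fun x y h => bracket_le_of_norm_le hs0 h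
  have hβneg : ∀ x, β (-x) = β x := fun x => by simp [hβ]
  have hdec' : ∀ x, ‖m x‖ₑ ≤ ENNReal.ofReal C * β x := enorm_le_of_decay hdec
  -- the integrand of the outer two integrals and its majorant
  set G : E × E → ℝ := fun p => (2 * ‖p.2‖)⁻¹ *
    ∫ b : ↥(ℝ ∙ p.2)ᗮ, cubicForm m p.1 (p.1 + p.2) (p.1 + p.2 + (b : E)) (p.1 + (b : E)) with hG
  set D : E × E → ℝ≥0∞ := fun p => ENNReal.ofReal ((2 * ‖p.2‖)⁻¹) * ∫⁻ b : ↥(ℝ ∙ p.2)ᗮ,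
    ENNReal.ofReal C ^ 3 * (β (p.1 + p.2) * β (p.1 + p.2 + b) * β (p.1 + b) +
      β p.1 * β (p.1 + p.2 + b) * β (p.1 + b) + β p.1 * β (p.1 + p.2) * β (p.1 + b) +
      β p.1 * β (p.1 + p.2) * β (p.1 + p.2 + b)) with hD
  have hGm : StronglyMeasurable G :=
    stronglyMeasurable_weight_mul_integral_hyperplane measurable_snd
      (Φ := fun p b => cubicForm m p.1 (p.1 + p.2) (p.1 + p.2 + b) (p.1 + b))
      (measurable_cubicForm_param hm)
  have hDm : Measurable D :=
    measurable_weight_mul_lintegral_hyperplane measurable_snd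
      (Φ := fun (p : E × E) b => ENNReal.ofReal C ^ 3 * (β (p.1 + p.2) * β (p.1 + p.2 + b) *
        β (p.1 + b) + β p.1 * β (p.1 + p.2 + b) * β (p.1 + b) + β p.1 * β (p.1 + p.2) * β (p.1 + b) +
        β p.1 * β (p.1 + p.2) * β (p.1 + p.2 + b))) (by fun_prop)
  -- domination by the majorant
  have hGle : ∀ p : E × E, ‖G p‖ₑ ≤ D p := by
    intro p
    rw [hG, hD]
    dsimp only
    rw [enorm_mul, Real.enorm_eq_ofReal (by positivity)]
    gcongr
    exact (enorm_integral_le_lintegral_enorm _).trans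
      (lintegral_mono fun b => enorm_cubicForm_le hdec' _ _ _ _)
  have hGint : Integrable G (volume.prod volume) := by
    refine ⟨hGm.aestronglyMeasurable, ?_⟩
    rw [hasFiniteIntegral_iff_enorm]
    calc ∫⁻ p, ‖G p‖ₑ ∂(volume.prod volume)
        ≤ ∫⁻ p, D p ∂(volume.prod volume) := lintegral_mono hGle
      _ = ∫⁻ k : E, ∫⁻ a : E, D (k, a) := lintegral_prod _ hDm.aemeasurable
      _ < ⊤ := by
          rw [hD]
          dsimp only
          rw [lintegral_weight_const_mul_sum3 hβm]
          exact ENNReal.mul_lt_top (ENNReal.pow_lt_top ENNReal.ofReal_lt_top)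
            (lintegral_weight_sum3_lt_top hβm hβ2 hβneg ENNReal.ofReal_ne_top
              (finite_integral_one_add_norm hs).ne (lintegral_weight_mul_bracket_lt_top hE hs))
  -- the pointwise antisymmetry of `G` under `(k, a) ↦ (k + a, −a)` (Nazarenko's exchange
  -- `(k, k₂) ⇄ (k₁, k₃)`: `cubicForm m k₁ k k₃ k₂ = -cubicForm m k k₁ k₂ k₃`)
  have hswap : ∀ k k₁ k₂ k₃ : E, cubicForm m k₁ k k₃ k₂ = -cubicForm m k k₁ k₂ k₃ := by
    intro k k₁ k₂ k₃; unfold cubicForm; ring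
  have hspan : ∀ a : E, (ℝ ∙ (-a)) = (ℝ ∙ a) := fun a => by
    rw [← Set.neg_singleton, Submodule.span_neg]
  have hGanti : ∀ k a : E, G (k + a, -a) = -G (k, a) := by
    intro k a
    simp only [hG, norm_neg]
    rw [integral_orthogonal_congr (hspan a)
      (fun x => cubicForm m (k + a) (k + a + -a) (k + a + -a + x) (k + a + x)), ← mul_neg,
      ← integral_neg]
    congr 1
    refine integral_congr_ae (Eventually.of_forall fun b => ?_)
    simp only [add_neg_cancel_right]
    rw [← hswap]
  -- Fubini and the changes of variables
  have hneg : MeasurePreserving (fun p : E × E => (p.1, -p.2)) (volume.prod volume)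
      (volume.prod volume) :=
    (MeasurePreserving.id volume).prod (Measure.measurePreserving_neg volume)
  have hGint' : Integrable (fun p : E × E => G (p.1, -p.2)) (volume.prod volume) :=
    (hneg.integrable_comp hGm.aestronglyMeasurable).mpr hGint
  have hS : ∫ k, collision m k = ∫ k, ∫ a, G (k, a) := rfl
  have key : ∫ k, ∫ a, G (k, a) = -∫ k, ∫ a, G (k, a) := by
    calc ∫ k, ∫ a, G (k, a) = ∫ k, ∫ a, G (k, -a) := by
          congr 1; ext k; exact (integral_neg_eq_self (fun a => G (k, a)) volume).symm
      _ = ∫ a, ∫ k, G (k, -a) :=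
          integral_integral_swap (f := fun k a => G (k, -a)) hGint'
      _ = ∫ a, ∫ k, G (k + a, -a) := by
          congr 1; ext a; exact (integral_add_right_eq_self (fun k => G (k, -a)) a).symm
      _ = ∫ a, ∫ k, -G (k, a) := by simp_rw [hGanti]
      _ = -∫ a, ∫ k, G (k, a) := by simp_rw [integral_neg]
      _ = -∫ k, ∫ a, G (k, a) := by
          rw [integral_integral_swap (f := fun a k => G (k, a)) hGint.swap]
  rw [hS]
  linarith

end Vanishing

/-! ### 2.5 Conservation of mass -/

section MassConservation

/-- A measurable function with `|m| ≤ C ⟨·⟩^{-s}`, `s > dim E`, is integrable. [folklore] -/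
theorem integrable_of_decay {s C : ℝ} (hs : (finrank ℝ E : ℝ) < s) {m : E → ℝ}
    (hm : Measurable m) (hdec : ∀ x, |m x| ≤ C * (1 + ‖x‖) ^ (-s)) : Integrable m :=
  ((integrable_one_add_norm hs).const_mul C).mono' hm.aestronglyMeasurable
    (Eventually.of_forall fun x => by simpa [Real.norm_eq_abs] using hdec x)

/-- **Conservation of mass (wave action) for the wave kinetic equation** — discharge of the
named fact `IsWKESolutionOn.mass_conserved`: for a classical solution on `[0, T)` with
`|n(t, k)| ≤ C ⟨k⟩^{-s}`, `s > dim E ≥ 3`, the mass `M(t) = ∫ n(t, k) dk` is constant. Proof: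
`M` is continuous (dominated convergence) and has right derivative
`∫ 𝒦(n(t))(k) dk = 0` at every `t` (dominated convergence for the difference quotients, the
domination `|n(t+h,k) − n(t,k)| ≤ h g(k)` coming from the right-derivative mean value
inequality and `enorm_collision_le`; the value `0` from `integral_collision_eq_zero`,
i.e. Nazarenko's symmetrisation), hence is constant (`constant_of_has_deriv_right_zero`).
[cite: Nazarenko2011, §8.1.3 (8.18)–(8.22)] -/
theorem IsWKESolutionOn.mass_conserved_holds : IsWKESolutionOn.mass_conserved (E := E) := by
  intro T s n hn hE hs hdecay hmeas t ht
  obtain ⟨C, hC⟩ := hdecay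
  have hE2 : 2 ≤ finrank ℝ E := le_trans (by norm_num) hE
  have hs0 : 0 ≤ s := le_trans (Nat.cast_nonneg _) hs.le
  -- integrability of `n τ`
  have hint : ∀ τ ∈ Ico (0 : ℝ) T, Integrable (n τ) := fun τ hτ =>
    integrable_of_decay hs (hmeas τ hτ) (hC τ hτ)
  -- the bracket weight and its properties
  set β : E → ℝ≥0∞ := fun x => ENNReal.ofReal ((1 + ‖x‖) ^ (-s)) with hβ
  have hβm : Measurable β := by rw [hβ]; fun_prop
  have hβ2 : ∀ x y : E, ‖y‖ ≤ 1 + 2 * ‖x‖ → β x ≤ ENNReal.ofReal (2 ^ s) * β y :=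
    fun x y h => bracket_le_of_norm_le hs0 h
  have hβneg : ∀ x, β (-x) = β x := fun x => by simp [hβ]
  have hdec' : ∀ τ ∈ Ico (0 : ℝ) T, ∀ x, ‖n τ x‖ₑ ≤ ENNReal.ofReal C * β x :=
    fun τ hτ => enorm_le_of_decay (hC τ hτ)
  -- the time-uniform majorant `g` of the collision term
  set g : E → ℝ≥0∞ := fun k => ∫⁻ a : E, ENNReal.ofReal ((2 * ‖a‖)⁻¹) * ∫⁻ b : ↥(ℝ ∙ a)ᗮ,
    ENNReal.ofReal C ^ 3 * (β (k + a) * β (k + a + b) * β (k + b) +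
      β k * β (k + a + b) * β (k + b) + β k * β (k + a) * β (k + b) +
      β k * β (k + a) * β (k + a + b)) with hg
  have hg_meas : Measurable g := measurable_majorant hβm _
  have hg_lt : ∫⁻ k, g k < ⊤ := by
    rw [hg]
    dsimp only
    rw [lintegral_weight_const_mul_sum3 hβm]
    exact ENNReal.mul_lt_top (ENNReal.pow_lt_top ENNReal.ofReal_lt_top)
      (lintegral_weight_sum3_lt_top hβm hβ2 hβneg ENNReal.ofReal_ne_top
        (finite_integral_one_add_norm hs).ne (lintegral_weight_mul_bracket_lt_top hE2 hs))
  have hg_ae : ∀ᵐ k : E, g k < ⊤ := ae_lt_top hg_meas hg_lt.ne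
  have hgi : Integrable (fun k => (g k).toReal) :=
    integrable_toReal_of_lintegral_ne_top hg_meas.aemeasurable hg_lt.ne
  have hcoll : ∀ τ ∈ Ico (0 : ℝ) T, ∀ k, g k < ⊤ → ‖collision (n τ) k‖ ≤ (g k).toReal := by
    intro τ hτ k hk
    rw [← ENNReal.ofReal_le_iff_le_toReal hk.ne, ofReal_norm]
    exact enorm_collision_le (hdec' τ hτ) k
  -- the mass and its continuity
  set M : ℝ → ℝ := fun τ => ∫ k, n τ k with hM
  have hsub : Icc 0 t ⊆ Ico 0 T := fun τ hτ => ⟨hτ.1, hτ.2.trans_lt ht.2⟩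
  have hMcont : ContinuousOn M (Icc 0 t) := by
    refine continuousOn_of_dominated (bound := fun k => C * (1 + ‖k‖) ^ (-s)) ?_ ?_ ?_ ?_
    · exact fun τ hτ => (hmeas τ (hsub hτ)).aestronglyMeasurable
    · exact fun τ hτ => Eventually.of_forall fun k => by
        simpa [Real.norm_eq_abs] using hC τ (hsub hτ) k
    · exact (integrable_one_add_norm hs).const_mul C
    · exact Eventually.of_forall fun k => (hn k).1.mono hsub
  -- zero right derivative
  have hMderiv : ∀ x ∈ Ico 0 t, HasDerivWithinAt M 0 (Ici x) x := by
    intro x hx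
    have hxT : x ∈ Ico (0 : ℝ) T := ⟨hx.1, hx.2.trans ht.2⟩
    rw [← hasDerivWithinAt_Ioi_iff_Ici,
      hasDerivWithinAt_iff_tendsto_slope' (s := Ioi x) (lt_irrefl x),
      ← integral_collision_eq_zero hE2 hs (hmeas x hxT) (hC x hxT)]
    have hev : ∀ᶠ y in 𝓝[>] x, y ∈ Ioo x T := Ioo_mem_nhdsGT hxT.2
    -- the difference quotients as parametric integrals
    have heq : ∀ y ∈ Ioo x T, ∫ k, (y - x)⁻¹ * (n y k - n x k) = slope M x y := by
      intro y hy
      have hyT : y ∈ Ico (0 : ℝ) T := ⟨hx.1.trans hy.1.le, hy.2⟩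
      rw [slope_def_field, integral_const_mul, integral_sub (hint y hyT) (hint x hxT)]
      rw [hM]
      ring
    refine (tendsto_integral_filter_of_dominated_convergence (fun k => (g k).toReal) ?_ ?_ hgi
      ?_).congr' (by filter_upwards [hev] with y hy using heq y hy)
    · filter_upwards [hev] with y hy
      have hyT : y ∈ Ico (0 : ℝ) T := ⟨hx.1.trans hy.1.le, hy.2⟩
      exact (((hmeas y hyT).sub (hmeas x hxT)).const_mul _).aestronglyMeasurable
    · filter_upwards [hev] with y hy
      filter_upwards [hg_ae] with k hk
      have hIcc : Icc x y ⊆ Ico 0 T := fun σ hσ => ⟨hx.1.trans hσ.1, hσ.2.trans_lt hy.2⟩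
      have hmvt := norm_image_sub_le_of_norm_deriv_right_le_segment
        (f := fun σ => n σ k) (f' := fun σ => collision (n σ) k) (a := x) (b := y)
        (C := (g k).toReal) ((hn k).1.mono hIcc)
        (fun σ hσ => ((hn k).2 σ ⟨hx.1.trans hσ.1, hσ.2.trans hy.2⟩).2)
        (fun σ hσ => hcoll σ ⟨hx.1.trans hσ.1, hσ.2.trans hy.2⟩ k hk) y
        (right_mem_Icc.2 hy.1.le)
      have hyx : 0 < y - x := sub_pos.2 hy.1
      rw [norm_mul, norm_inv, Real.norm_eq_abs, abs_of_pos hyx]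
      calc (y - x)⁻¹ * ‖n y k - n x k‖ ≤ (y - x)⁻¹ * ((g k).toReal * (y - x)) := by gcongr
        _ = (g k).toReal := by field_simp
    · refine Eventually.of_forall fun k => ?_
      have hd := ((hn k).2 x hxT).2
      rw [hasDerivWithinAt_iff_tendsto_slope, Ici_sdiff_left] at hd
      refine hd.congr' (Eventually.of_forall fun y => ?_)
      rw [slope_def_field, div_eq_inv_mul]
  -- conclusion
  have := constant_of_has_deriv_right_zero hMcont hMderiv t (right_mem_Icc.2 ht.1)
  simpa [hM] using this

end MassConservation

end WaveKinetic

end Literature.Analysis.FluidPDE
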